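import Literature.Computability.AlgebraicComplexity.BooleanGadgets
import Literature.Computability.AlgebraicComplexity.RealTauConjectureDepthFour
import Literature.Computability.AlgebraicComplexity.RealTauConjectureDefinable
import HarnessLib

/-!
# The `VP` witness of a `P/poly`-definable family (Valiant's criterion, combinatorial core)

For one index `n` of a family of univariate integer polynomials definable in `P/poly`
(Tavenas 2014, Déf. 3.11–3.12, the tree's `IsDefinableSeqIn`), this file constructs the
polynomial `gW` of the proof of Tavenas' Prop. 3.17 (Valiant's criterion, Prop. 3.10 =
Bürgisser 2000, Prop. 2.20, applied to the bit language) and computes its Boolean sum.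

Data (`DefVNP.Params`): the unary index `N = n`, the number `D` of `x`-variables (bits of the
exponent `α`), the number `R` of `z`-variables (bits of the bit position `i`), the `α`-range
`2^P` of the definability guarantee, a `B₂`-circuit family `CF` deciding the bit language and a
bound `M` on its size at all relevant query lengths. Boolean variables (`BV`): the bits `e_α`
of `α` (`D`), the bits `e_j` of the queried position `j` (`R + 1`, since `j = i + 1 ≤ 2^R`), and
two transcript blocks `w, w'` of size `M`.

The witness is `gW = SC(e) · XMON · ZMON` where

* `XMON = ∏_t (e_{α,t} x_t + 1 - e_{α,t})` selects `x^α`, `ZMON` selects `z^{j-1}` through the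
  borrow chain `decBit` (`BooleanGadgets.lean`);
* `SC = ∑_{ℓα ≤ D} ∑_{ℓj ≤ R+1} IND · BIT · SGN` sums over the declared binary lengths of `α` and
  `j`: `IND` is the product of the length indicators with `[α < 2^P] [j ≠ 0] [j ≤ 2^R]`; `BIT` is
  the transcript arithmetization (`CircuitArithmetization.lean`) of the circuit at the query
  length `L = 2N + 2ℓα + ℓj + 4`, padded to `M` gates (`Circuit.padTo`), with the query word
  `(1^N # α, j)` substituted into its inputs as constants and bit variables (`wpoly`, `σb`) and
  the block `w` into its gate variables; `SGN = VALID · (1 - 2 OUT)` is the same for the sign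
  query `j = 0` with the block `w'`.

## Main statements

* `bsum_gW_eq`: for `mem` the membership function of the bit language
  (`hdec : (CF |x|)(x) = mem x`),
  `∑_{e ∈ {0,1}^{BV}} gW(x, z, e) = ∑_{α-bits} ∑_{i-bits} [α < 2^P] · [mem (1^N # α, i+1)] ·
    (1 - 2 [mem (1^N # α, 0)]) · x^α z^i`
  — with the sign-folded bit encoding (`sbit`) this is `∑_{α, i} sign(a_α) bit_i(|a_α|) x^α z^i`,
  the multilinear polynomial `h_n` of display (3.1);
* `complexity_gW_le : L(gW) ≤ gWCost D R M` and `totalDegree_gW_le`, polynomial bounds.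

The family-level statement (`h ∈ VNP`, and Prop. 3.17 from the `VNP`-completeness of the
permanent) is in `DefinableVNP.lean`.

## References

* S. Tavenas, *Bornes inférieures et supérieures dans les circuits arithmétiques*, PhD thesis,
  ENS Lyon 2014, Déf. 3.11–3.12, Prop. 3.10, Prop. 3.17 and its proof (display (3.1)).
* P. Bürgisser, *Completeness and Reduction in Algebraic Complexity Theory*, Springer 2000,
  Prop. 2.20 (Valiant's criterion), Def. 2.1, Def. 2.5, Def. 2.6.
* L. G. Valiant, *Completeness classes in algebra*, STOC 1979.
-/

noncomputable section

open MvPolynomial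

universe u v w

namespace Literature.Computability.AlgebraicComplexity

open Complexity CircuitArith BoolGadgets

/-! ### The transcript sum against an arbitrary weight -/

namespace CircuitArith

variable {k : Type u} [CommRing k] {ι : Type v}

/-- The true transcript of `Q` on `b` as a function. [cite: Burgisser2000, proof of Prop. 2.20] -/
def trueTranscript (Q : Circuit ι) (b : ι → Bool) : Fin Q.size → Bool :=
  fun j => (transcript b [] Q.gates)[j.val]'(by rw [length_transcript, List.length_nil, zero_add]; exact j.isLt)

/-- `ofFn (trueTranscript Q b)` is the transcript. [folklore] -/
theorem ofFn_trueTranscript (Q : Circuit ι) (b : ι → Bool) :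
    List.ofFn (trueTranscript Q b) = transcript b [] Q.gates := by
  apply List.ext_getElem (by rw [List.length_ofFn, length_transcript, List.length_nil, zero_add]; rfl)
  intro i h1 h2
  rw [List.getElem_ofFn]; rfl

/-- `ofFn y` is the transcript iff `y` is the true transcript. [folklore] -/
theorem ofFn_eq_transcript_iff (Q : Circuit ι) (b : ι → Bool) (y : Fin Q.size → Bool) :
    List.ofFn y = transcript b [] Q.gates ↔ y = trueTranscript Q b := by
  constructor
  · intro h
    funext j
    have := List.getElem_of_eq h (i := j.val) (by simp)
    rw [List.getElem_ofFn] at this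
    exact this
  · rintro rfl; exact ofFn_trueTranscript Q b

/-- **The transcript sum against a weight**: `∑_y VALID(b, y) · F(y) = F(true transcript)`. [cite: Burgisser2000, proof of Prop. 2.20] -/
theorem sum_eval_validPoly_mul (Q : Circuit ι) (hQ : Q.IsOver B2) (b : ι → Bool)
    (F : (Fin Q.size → Bool) → k) :
    ∑ y : Fin Q.size → Bool, eval (bpt k b y) (validPoly Q) * F y = F (trueTranscript Q b) := by
  classical
  simp only [eval_validPoly Q hQ b]
  rw [Finset.sum_eq_single (trueTranscript Q b)]
  · rw [decide_eq_true (ofFn_trueTranscript Q b), toK_true, one_mul]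
  · intro y _ hy
    rw [decide_eq_false (fun h => hy ((ofFn_eq_transcript_iff Q b y).1 h)), toK_false, zero_mul]
  · intro h; exact absurd (Finset.mem_univ _) h

/-- The output wire at the true transcript is the circuit's value. [folklore] -/
theorem bwval_trueTranscript_output (Q : Circuit ι) (b : ι → Bool) :
    bwval b (trueTranscript Q b) Q.output = Q.eval b := by
  rw [bwval_eq_wireVal, ofFn_trueTranscript, eval_eq_wireVal]

/-- The sign polynomial `VALID · (1 - 2 OUT)`. [cite: Tavenas2014, proof of Prop. 3.17] -/
def sgnArith (Q : Circuit ι) : MvPolynomial (ι ⊕ Fin Q.size) k :=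
  validPoly Q * (1 - 2 * wirePoly Q.size Q.output)

/-- **The sign transcript sum**: `∑_y VALID(b,y)(1 - 2 OUT(b,y)) = 1 - 2 [Q(b)]`. [cite: Tavenas2014, proof of Prop. 3.17] -/
theorem sum_eval_sgnArith (Q : Circuit ι) (hQ : Q.IsOver B2) (b : ι → Bool) :
    ∑ y : Fin Q.size → Bool, eval (bpt k b y) (sgnArith Q) = 1 - 2 * toK k (Q.eval b) := by
  unfold sgnArith
  simp only [map_mul]
  rw [sum_eval_validPoly_mul Q hQ b fun y => eval (bpt k b y) (1 - 2 * wirePoly Q.size Q.output)]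
  rw [map_sub, map_one, map_mul, eval_wirePoly, bwval_trueTranscript_output]
  congr 2
  simp

/-- `L(sgnArith Q) ≤ 60 |Q| + 5`. [cite: Burgisser2000, Def. 2.1] -/
theorem complexity_sgnArith_le (Q : Circuit ι) : complexity (sgnArith (k := k) Q) ≤ 60 * Q.size + 5 := by
  unfold sgnArith
  refine (complexity_mul_le_holds _ _).trans ?_
  have h1 : complexity (validPoly (k := k) Q) ≤ 60 * Q.size := by
    unfold validPoly
    refine (complexity_finset_prod_le _ _).trans ?_
    calc ∑ j : Fin Q.size, complexity (consPoly (k := k) Q j) + (Finset.univ : Finset (Fin Q.size)).card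
        ≤ ∑ _j : Fin Q.size, 59 + (Finset.univ : Finset (Fin Q.size)).card := by
          gcongr with j; exact complexity_consPoly_le Q j
      _ = 60 * Q.size := by simp only [Finset.sum_const, Finset.card_univ, Fintype.card_fin, smul_eq_mul]; omega
  have h2 : complexity (1 - 2 * wirePoly (k := k) Q.size Q.output) ≤ 3 := by
    refine (complexity_one_sub_le _).trans ?_
    rw [show (2 : MvPolynomial (ι ⊕ Fin Q.size) k) * wirePoly Q.size Q.output = (2 : k) • wirePoly Q.size Q.output by
      rw [smul_eq_C_mul, map_ofNat]]
    have := complexity_smul_le_holds (2 : k) (wirePoly (k := k) Q.size Q.output)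
    rw [complexity_wirePoly] at this
    omega
  omega

/-- `deg (sgnArith Q) ≤ 3 |Q| + 1`. [folklore] -/
theorem totalDegree_sgnArith_le (Q : Circuit ι) : (sgnArith (k := k) Q).totalDegree ≤ 3 * Q.size + 1 := by
  unfold sgnArith
  refine (totalDegree_mul _ _).trans (Nat.add_le_add ?_ ?_)
  · unfold validPoly
    refine (totalDegree_finsetProd _ _).trans ?_
    calc ∑ j : Fin Q.size, (consPoly (k := k) Q j).totalDegree ≤ ∑ _j : Fin Q.size, 3 :=
          Finset.sum_le_sum fun j _ => totalDegree_consPoly_le Q j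
      _ = 3 * Q.size := by simp [mul_comm]
  · refine (totalDegree_one_sub_le _).trans ((totalDegree_mul _ _).trans ?_)
    have h2 : (2 : MvPolynomial (ι ⊕ Fin Q.size) k).totalDegree = 0 := by
      rw [show (2 : MvPolynomial (ι ⊕ Fin Q.size) k) = C 2 from (map_ofNat C 2).symm]; exact totalDegree_C _
    have := totalDegree_wirePoly_le (k := k) (s := Q.size) Q.output
    omega

end CircuitArith

/-! ### Query words as lists -/

namespace DefVNP

/-- Double every entry (the first-component encoding of `boolPair`; the `Bool` case is
`StrCopy.dup` of `StringCopy.lean`, here for an arbitrary alphabet since it is applied to lists of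
polynomials as well). [cite: AroraBarak2009, §0.1] -/
def dup2 {γ : Type*} (l : List γ) : List γ := l.flatMap fun b => [b, b]

/-- The generic query word `⟨1^N, ⟨la, lj⟩⟩` over an alphabet with two distinguished symbols
`tt, ff`: `dup2 (tt^N) ++ [ff, tt] ++ dup2 la ++ [ff, tt] ++ lj`. [cite: Tavenas2014, Déf. 3.11] -/
def wordG {γ : Type*} (tt ff : γ) (N : ℕ) (la lj : List γ) : List γ :=
  dup2 (List.replicate N tt) ++ [ff, tt] ++ dup2 la ++ [ff, tt] ++ lj

/-- Length of `dup2`. [folklore] -/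
@[simp] theorem length_dup2 {γ : Type*} (l : List γ) : (dup2 l).length = 2 * l.length := by
  induction l with
  | nil => rfl
  | cons a l ih => simp [dup2, List.flatMap_cons] at ih ⊢; omega

/-- `dup2` commutes with `map`. [folklore] -/
theorem map_dup2 {γ δ : Type*} (f : γ → δ) (l : List γ) : (dup2 l).map f = dup2 (l.map f) := by
  induction l with
  | nil => rfl
  | cons a l ih => simp [dup2, List.flatMap_cons] at ih ⊢; exact ih

/-- Length of the generic word. [folklore] -/
theorem length_wordG {γ : Type*} (tt ff : γ) (N : ℕ) (la lj : List γ) :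
    (wordG tt ff N la lj).length = 2 * N + 2 * la.length + lj.length + 4 := by
  simp [wordG]; omega

/-- The generic word commutes with `map`. [folklore] -/
theorem map_wordG {γ δ : Type*} (f : γ → δ) (tt ff : γ) (N : ℕ) (la lj : List γ) :
    (wordG tt ff N la lj).map f = wordG (f tt) (f ff) N (la.map f) (lj.map f) := by
  simp [wordG, map_dup2, List.map_replicate]

/-- **Tavenas' query word is the generic word on the binary numerals.** [cite: Tavenas2014, Déf. 3.11] -/
theorem encUQuery_eq_wordG (N α j : ℕ) :
    encUQuery N α j = wordG true false N (Computability.encodeNat α) (Computability.encodeNat j) := by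
  rw [encUQuery, boolPair, boolPair, unaryEncodeNat_eq_replicate]
  simp [wordG, dup2, List.append_assoc]

/-- The bits of `bitsToNat l` are the entries of `l` (the same statement is proved independently in
`Literature/Cryptography/ShorOrdPost.lean`, not imported into this part of the library; librarian:
hoist next to `bitsToNat` in `BoolEncodings.lean`). [folklore] -/
theorem testBit_bitsToNat (l : List Bool) (t : ℕ) : (bitsToNat l).testBit t = l.getD t false := by
  induction l generalizing t with
  | nil => simp
  | cons b l ih =>
    rw [bitsToNat_cons]
    cases t with
    | zero =>
      rw [Nat.testBit_zero]
      cases b <;> simp [Nat.add_mod]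
    | succ t =>
      rw [Nat.testBit_add_one, List.getD_cons_succ, ← ih]
      congr 1
      have hb : b.toNat ≤ 1 := Bool.toNat_le b
      omega

/-- **The binary numeral of `v` is the list of its `Nat.size v` low bits.** [folklore] -/
theorem encodeNat_eq_ofFn (v : ℕ) :
    Computability.encodeNat v = List.ofFn fun t : Fin (Nat.size v) => v.testBit t := by
  have hlen : (Computability.encodeNat v).length = Nat.size v := by
    symm
    rw [size_eq_iff]
    constructor
    · have := bitsToNat_lt (Computability.encodeNat v)
      rwa [bitsToNat_encodeNat] at this
    · by_cases hnil : Computability.encodeNat v = []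
      · left; rw [hnil]; rfl
      · right
        have := TavRecode.two_pow_length_le_bitsToNat (isCanonicalNum_encodeNat v) hnil
        rwa [bitsToNat_encodeNat] at this
  apply List.ext_getElem (by rw [List.length_ofFn, hlen])
  intro i h1 h2
  rw [List.getElem_ofFn]
  have := testBit_bitsToNat (Computability.encodeNat v) i
  rw [bitsToNat_encodeNat, List.getD_eq_getElem _ _ h1] at this
  exact this.symm

/-- The length of the binary numeral is the binary length `Nat.size` (the same statement is
proved independently as `length_encodeNat` in `Literature/Cryptography/ShorClassicalOracle.lean`,
which is not imported into this part of the library; librarian: merge). [folklore] -/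
theorem length_encodeNat_eq_size (v : ℕ) : (Computability.encodeNat v).length = Nat.size v := by
  rw [encodeNat_eq_ofFn, List.length_ofFn]

/-- **The word read off the bits equals Tavenas' query word** when the declared lengths are the
binary lengths. [cite: Tavenas2014, Déf. 3.11] -/
theorem wordG_bits_eq_encUQuery {D R' : ℕ} (N ℓα ℓj : ℕ) (eα : Fin D → Bool) (eJ : Fin R' → Bool)
    (hℓα : ℓα ≤ D) (hℓj : ℓj ≤ R') (hα : Nat.size (Nat.ofBits eα) = ℓα) (hj : Nat.size (Nat.ofBits eJ) = ℓj) :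
    wordG true false N (List.ofFn fun t : Fin ℓα => eα ⟨t, lt_of_lt_of_le t.isLt hℓα⟩)
        (List.ofFn fun t : Fin ℓj => eJ ⟨t, lt_of_lt_of_le t.isLt hℓj⟩) =
      encUQuery N (Nat.ofBits eα) (Nat.ofBits eJ) := by
  rw [encUQuery_eq_wordG, encodeNat_eq_ofFn, encodeNat_eq_ofFn]
  have hA : (List.ofFn fun t : Fin ℓα => eα ⟨t, lt_of_lt_of_le t.isLt hℓα⟩) =
      List.ofFn fun t : Fin (Nat.size (Nat.ofBits eα)) => (Nat.ofBits eα).testBit t := by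
    subst hα
    congr 1
    funext t
    rw [Nat.testBit_ofBits, dif_pos]
  have hJ : (List.ofFn fun t : Fin ℓj => eJ ⟨t, lt_of_lt_of_le t.isLt hℓj⟩) =
      List.ofFn fun t : Fin (Nat.size (Nat.ofBits eJ)) => (Nat.ofBits eJ).testBit t := by
    subst hj
    congr 1
    funext t
    rw [Nat.testBit_ofBits, dif_pos]
  rw [hA, hJ]

/-! ### The parameters of one member of the family -/

/-- The data of the witness for one index `n`: the unary length `N = n`, the numbers `D` of
`x`-variables (bits of `α`), `R` of `z`-variables (bits of the bit position), the guaranteed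
`α`-range `2^P`, the gate-variable block size `M`, and the `B₂`-circuit family deciding the bit
language, of size `≤ M` at all relevant word lengths. [cite: Tavenas2014, proof of Prop. 3.17] -/
structure Params where
  /-- unary index -/
  N : ℕ
  /-- number of `α`-bits -/
  D : ℕ
  /-- number of bit-position bits -/
  R : ℕ
  /-- `α`-range exponent of the definability guarantee -/
  P : ℕ
  /-- gate-variable block size -/
  M : ℕ
  /-- the circuits of the bit language -/
  CF : CircuitFamily
  /-- basis `B₂` (fan-in two) -/
  har : ∀ ℓ, (CF ℓ).IsOver B2
  /-- size bound at the relevant lengths -/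
  hM : ∀ ℓ, ℓ ≤ 2 * N + 2 * D + (R + 1) + 4 → (CF ℓ).size ≤ M

variable {k : Type u} [CommRing k] (π : Params)

/-- The Boolean variables: bits of `α`, bits of `j` (`R + 1` of them), two transcript blocks. [cite: Tavenas2014, proof of Prop. 3.17] -/
abbrev BV : Type := Fin π.D ⊕ (Fin (π.R + 1) ⊕ (Fin π.M ⊕ Fin π.M))

/-- The variables of `h_n`: `x_0, …, x_{D-1}` and `z_0, …, z_{R-1}`. [cite: Tavenas2014, proof of Prop. 3.17, (3.1)] -/
abbrev XZ : Type := Fin π.D ⊕ Fin π.R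

/-- The `α`-bit variables. [folklore] -/
def EAv (t : Fin π.D) : MvPolynomial (BV π) k := X (Sum.inl t)
/-- The `j`-bit variables. [folklore] -/
def EJv (t : Fin (π.R + 1)) : MvPolynomial (BV π) k := X (Sum.inr (Sum.inl t))
/-- The first transcript block. [folklore] -/
def Wv (m : Fin π.M) : MvPolynomial (BV π) k := X (Sum.inr (Sum.inr (Sum.inl m)))
/-- The second transcript block. [folklore] -/
def W'v (m : Fin π.M) : MvPolynomial (BV π) k := X (Sum.inr (Sum.inr (Sum.inr m)))

/-- The `α`-bit variable `t` (or `0` out of range). [folklore] -/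
def EA' (t : ℕ) : MvPolynomial (BV π) k := if h : t < π.D then EAv π ⟨t, h⟩ else 0
/-- The `j`-bit variable `t` (or `0` out of range). [folklore] -/
def EJ' (t : ℕ) : MvPolynomial (BV π) k := if h : t < π.R + 1 then EJv π ⟨t, h⟩ else 0

/-- A Boolean assignment of all Boolean variables from its four blocks. [folklore] -/
def join (eA : Fin π.D → Bool) (eJ : Fin (π.R + 1) → Bool) (w w' : Fin π.M → Bool) : BV π → Bool :=
  Sum.elim eA (Sum.elim eJ (Sum.elim w w'))

/-- The Boolean point of an assignment. [folklore] -/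
def pt (e : BV π → Bool) : BV π → k := toK k ∘ e

/-- Bit `t` of `α` (or `0` out of range). [folklore] -/
def bA' (eA : Fin π.D → Bool) (t : ℕ) : Bool := if h : t < π.D then eA ⟨t, h⟩ else false
/-- Bit `t` of `j` (or `0` out of range). [folklore] -/
def bJ' (eJ : Fin (π.R + 1) → Bool) (t : ℕ) : Bool := if h : t < π.R + 1 then eJ ⟨t, h⟩ else false

section EvalVars

variable (eA : Fin π.D → Bool) (eJ : Fin (π.R + 1) → Bool) (w w' : Fin π.M → Bool)

/-- `EAv` at a Boolean point. [folklore] -/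
@[simp] theorem eval_EAv (t : Fin π.D) : eval (pt π (join π eA eJ w w')) (EAv (k := k) π t) = toK k (eA t) := by
  simp [EAv, pt, join]
/-- `EJv` at a Boolean point. [folklore] -/
@[simp] theorem eval_EJv (t : Fin (π.R + 1)) : eval (pt π (join π eA eJ w w')) (EJv (k := k) π t) = toK k (eJ t) := by
  simp [EJv, pt, join]
/-- `Wv` at a Boolean point. [folklore] -/
@[simp] theorem eval_Wv (m : Fin π.M) : eval (pt π (join π eA eJ w w')) (Wv (k := k) π m) = toK k (w m) := by
  simp [Wv, pt, join]
/-- `W'v` at a Boolean point. [folklore] -/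
@[simp] theorem eval_W'v (m : Fin π.M) : eval (pt π (join π eA eJ w w')) (W'v (k := k) π m) = toK k (w' m) := by
  simp [W'v, pt, join]
/-- `EA'` at a Boolean point. [folklore] -/
theorem eval_EA' (t : ℕ) : eval (pt π (join π eA eJ w w')) (EA' (k := k) π t) = toK k (bA' π eA t) := by
  unfold EA' bA'; split <;> simp
/-- `EJ'` at a Boolean point. [folklore] -/
theorem eval_EJ' (t : ℕ) : eval (pt π (join π eA eJ w w')) (EJ' (k := k) π t) = toK k (bJ' π eJ t) := by
  unfold EJ' bJ'; split <;> simp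

end EvalVars

/-! ### Query words: as polynomials and as bits -/

/-- The length of the query word for declared lengths `(ℓα, ℓj)`. [cite: Tavenas2014, Déf. 3.11] -/
def L (ℓα ℓj : ℕ) : ℕ := 2 * π.N + 2 * ℓα + ℓj + 4

/-- The query word as a list of polynomials (constants `0/1` and bit variables). [cite: Tavenas2014, proof of Prop. 3.17] -/
def wpoly (ℓα ℓj : ℕ) : List (MvPolynomial (BV π) k) :=
  wordG 1 0 π.N (List.ofFn fun t : Fin ℓα => EA' π t) (List.ofFn fun t : Fin ℓj => EJ' π t)

/-- The query word as bits, read off a Boolean assignment. [cite: Tavenas2014, Déf. 3.11] -/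
def wbits (ℓα ℓj : ℕ) (eA : Fin π.D → Bool) (eJ : Fin (π.R + 1) → Bool) : List Bool :=
  wordG true false π.N (List.ofFn fun t : Fin ℓα => bA' π eA t) (List.ofFn fun t : Fin ℓj => bJ' π eJ t)

/-- Length of the polynomial word. [folklore] -/
@[simp] theorem length_wpoly (ℓα ℓj : ℕ) : (wpoly (k := k) π ℓα ℓj).length = L π ℓα ℓj := by
  simp [wpoly, length_wordG, L]

/-- Length of the bit word. [folklore] -/
@[simp] theorem length_wbits (ℓα ℓj : ℕ) (eA : Fin π.D → Bool) (eJ : Fin (π.R + 1) → Bool) :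
    (wbits π ℓα ℓj eA eJ).length = L π ℓα ℓj := by
  simp [wbits, length_wordG, L]

/-- **The polynomial word evaluates to the bit word.** [folklore] -/
theorem map_eval_wpoly (ℓα ℓj : ℕ) (eA : Fin π.D → Bool) (eJ : Fin (π.R + 1) → Bool) (w w' : Fin π.M → Bool) :
    (wpoly (k := k) π ℓα ℓj).map (eval (pt π (join π eA eJ w w'))) = (wbits π ℓα ℓj eA eJ).map (toK k) := by
  unfold wpoly wbits
  rw [map_wordG, map_wordG, map_one, map_zero, toK_true, toK_false, List.map_ofFn, List.map_ofFn,
    List.map_ofFn, List.map_ofFn]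
  congr 2
  · funext t; exact eval_EA' π eA eJ w w' t
  · funext t; exact eval_EJ' π eA eJ w w' t

/-- The bit word as a function on positions. [folklore] -/
def wfun (ℓα ℓj : ℕ) (eA : Fin π.D → Bool) (eJ : Fin (π.R + 1) → Bool) : Fin (L π ℓα ℓj) → Bool :=
  fun q => (wbits π ℓα ℓj eA eJ).getD q false

/-- **The bit word is Tavenas' query word** when the declared lengths are the binary lengths. [cite: Tavenas2014, Déf. 3.11] -/
theorem wbits_eq_encUQuery {ℓα ℓj : ℕ} (hℓα : ℓα ≤ π.D) (hℓj : ℓj ≤ π.R + 1) (eA : Fin π.D → Bool)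
    (eJ : Fin (π.R + 1) → Bool) (hα : Nat.size (Nat.ofBits eA) = ℓα) (hj : Nat.size (Nat.ofBits eJ) = ℓj) :
    wbits π ℓα ℓj eA eJ = encUQuery π.N (Nat.ofBits eA) (Nat.ofBits eJ) := by
  rw [wbits, ← wordG_bits_eq_encUQuery π.N ℓα ℓj eA eJ hℓα hℓj hα hj]
  congr 2
  · funext t; simp [bA', lt_of_lt_of_le t.isLt hℓα]
  · funext t; simp [bJ', lt_of_lt_of_le t.isLt hℓj]

/-! ### The circuits and the transcript gadgets -/

/-- The bit-language circuit at word length `L(ℓα, ℓj)`, padded to size `M`. [cite: Tavenas2014, proof of Prop. 3.17] -/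
def Qw (ℓα ℓj : ℕ) : Circuit (Fin (L π ℓα ℓj)) := (π.CF (L π ℓα ℓj)).padTo π.M

/-- The padded circuits are `B₂`-circuits. [folklore] -/
theorem isOver_Qw (ℓα ℓj : ℕ) : (Qw π ℓα ℓj).IsOver B2 :=
  Circuit.isOver_B2_padTo _ _ (π.har _)

/-- In range, the padded circuit has size exactly `M`. [folklore] -/
theorem size_Qw {ℓα ℓj : ℕ} (hℓα : ℓα ≤ π.D) (hℓj : ℓj ≤ π.R + 1) : (Qw π ℓα ℓj).size = π.M :=
  Circuit.size_padTo _ (π.hM _ (by unfold L; omega))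

/-- The substitution feeding the word into the inputs and the block `Wv` into the gate variables. [cite: Tavenas2014, proof of Prop. 3.17] -/
def σb (ℓα ℓj : ℕ) : Fin (L π ℓα ℓj) ⊕ Fin (Qw π ℓα ℓj).size → MvPolynomial (BV π) k :=
  Sum.elim (fun q => (wpoly π ℓα ℓj).getD q 0) (fun m => if h : m.val < π.M then Wv π ⟨m.val, h⟩ else 0)

/-- The same substitution with the block `W'v` (for the sign query, `ℓj = 0`). [cite: Tavenas2014, proof of Prop. 3.17] -/
def σs (ℓα : ℕ) : Fin (L π ℓα 0) ⊕ Fin (Qw π ℓα 0).size → MvPolynomial (BV π) k :=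
  Sum.elim (fun q => (wpoly π ℓα 0).getD q 0) (fun m => if h : m.val < π.M then W'v π ⟨m.val, h⟩ else 0)

/-- **The bit gadget**: the arithmetization of the bit query, `VALID · OUT` with the word substituted. [cite: Tavenas2014, proof of Prop. 3.17] -/
def BIT (ℓα ℓj : ℕ) : MvPolynomial (BV π) k := bind₁ (σb π ℓα ℓj) (arith (Qw π ℓα ℓj))

/-- **The sign gadget**: `VALID · (1 - 2 OUT)` for the sign query `j = 0`. [cite: Tavenas2014, proof of Prop. 3.17] -/
def SGN (ℓα : ℕ) : MvPolynomial (BV π) k := bind₁ (σs π ℓα) (sgnArith (Qw π ℓα 0))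

/-- The product of indicators: lengths `(ℓα, ℓj)`, `α < 2^P`, `j ≠ 0`, `j ≤ 2^R`. [cite: Tavenas2014, proof of Prop. 3.17] -/
def IND (ℓα ℓj : ℕ) : MvPolynomial (BV π) k :=
  lenInd (EAv π) ℓα * lenInd (EJv π) ℓj * allZeroFrom (EAv π) π.P * jnzInd (EJv π) * jleInd (EJv π)

/-- The scalar gadget of the pair `(ℓα, ℓj)`. [cite: Tavenas2014, proof of Prop. 3.17] -/
def SCAL (ℓα ℓj : ℕ) : MvPolynomial (BV π) k := IND π ℓα ℓj * BIT π ℓα ℓj * SGN π ℓα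

/-- The full scalar gadget: sum over the declared lengths. [cite: Tavenas2014, proof of Prop. 3.17] -/
def SC : MvPolynomial (BV π) k :=
  ∑ ℓα ∈ Finset.range (π.D + 1), ∑ ℓj ∈ Finset.range (π.R + 2), SCAL π ℓα ℓj

/-- The `x`-monomial selector `∏_t (e_{α,t} x_t + 1 - e_{α,t})`. [cite: Tavenas2014, proof of Prop. 3.17, (3.1)] -/
def XMON : MvPolynomial (XZ π ⊕ BV π) k :=
  selProd (fun t : Fin π.D => X (Sum.inr (Sum.inl t))) (fun t => X (Sum.inl (Sum.inl t)))

/-- The `z`-monomial selector on the bits of `j - 1` (borrow chain). [cite: Tavenas2014, proof of Prop. 3.17, (3.1)] -/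
def ZMON : MvPolynomial (XZ π ⊕ BV π) k :=
  selProd (fun t : Fin π.R => rename Sum.inr (decBit (EJv π) t.castSucc)) (fun t => X (Sum.inl (Sum.inr t)))

/-- **The `VP` witness** `g = SC(e) · XMON · ZMON`. [cite: Tavenas2014, proof of Prop. 3.17] -/
def gW : MvPolynomial (XZ π ⊕ BV π) k := rename Sum.inr (SC π) * XMON π * ZMON π

/-! ### Boolean sums -/

/-- The Boolean substitution of an assignment `e` of the Boolean variables. [cite: Burgisser2000, Def. 2.5] -/
def φb {σ β : Type*} (e : β → Bool) : σ ⊕ β → MvPolynomial σ k :=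
  Sum.elim X fun b => C (toK k (e b))

/-- Valiant's Boolean sum over a Boolean variable block `β`. [cite: Burgisser2000, Def. 2.5] -/
def bsum {σ β : Type*} [DecidableEq β] [Fintype β] (G : MvPolynomial (σ ⊕ β) k) : MvPolynomial σ k :=
  ∑ e : β → Bool, aeval (φb e) G

/-- Scalar gadgets under the Boolean substitution become constants. [folklore] -/
theorem aeval_φb_rename_inr {σ β : Type*} (e : β → Bool) (p : MvPolynomial β k) :
    aeval (φb (k := k) (σ := σ) e) (rename Sum.inr p) = C (eval (toK k ∘ e) p) := by
  rw [aeval_rename]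
  exact aeval_C_comp _ p

/-- The selected `x`-monomial. [cite: Tavenas2014, proof of Prop. 3.17, (3.1)] -/
def xsel (eA : Fin π.D → Bool) : MvPolynomial (XZ π) k := ∏ t : Fin π.D, (if eA t then X (Sum.inl t) else 1)

/-- The selected `z`-monomial. [cite: Tavenas2014, proof of Prop. 3.17, (3.1)] -/
def zsel (eI : Fin π.R → Bool) : MvPolynomial (XZ π) k := ∏ t : Fin π.R, (if eI t then X (Sum.inr t) else 1)

/-- The decremented bit-position vector (bits of `j - 1`, `R` of them). [folklore] -/
def dvec (eJ : Fin (π.R + 1) → Bool) : Fin π.R → Bool := fun t => decVec eJ t.castSucc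

/-- `XMON` under the Boolean substitution. [folklore] -/
theorem aeval_XMON (e : BV π → Bool) :
    aeval (φb (k := k) (σ := XZ π) e) (XMON (k := k) π) = xsel π (e ∘ Sum.inl) := by
  unfold XMON xsel
  rw [aeval_selProd _ _ _ (e ∘ Sum.inl)]
  · refine Finset.prod_congr rfl fun t _ => ?_
    rw [aeval_X]; rfl
  · intro t; simp [φb, MvPolynomial.algebraMap_eq]

/-- `ZMON` under the Boolean substitution. [folklore] -/
theorem aeval_ZMON (e : BV π → Bool) :
    aeval (φb (k := k) (σ := XZ π) e) (ZMON (k := k) π) = zsel π (dvec π (fun t => e (Sum.inr (Sum.inl t)))) := by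
  unfold ZMON zsel dvec
  rw [aeval_selProd _ _ _ (fun t : Fin π.R => decVec (fun t => e (Sum.inr (Sum.inl t))) t.castSucc)]
  · refine Finset.prod_congr rfl fun t _ => ?_
    rw [aeval_X]; rfl
  · intro t
    rw [aeval_φb_rename_inr, MvPolynomial.algebraMap_eq,
      eval_decBit (EJv π) (toK k ∘ e) (fun t => e (Sum.inr (Sum.inl t))) (fun t => by simp [EJv])]

/-- **The Boolean sum of the witness, first form.** [cite: Tavenas2014, proof of Prop. 3.17] -/
theorem bsum_gW_eq_sum : bsum (gW (k := k) π) =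
    ∑ e : BV π → Bool, C (eval (toK k ∘ e) (SC π)) * xsel π (e ∘ Sum.inl) *
      zsel π (dvec π (fun t => e (Sum.inr (Sum.inl t)))) := by
  unfold bsum gW
  refine Finset.sum_congr rfl fun e _ => ?_
  rw [map_mul, map_mul, aeval_φb_rename_inr, aeval_XMON, aeval_ZMON]

/-! ### Values of the gadgets at a Boolean point -/

section Values

variable (eA : Fin π.D → Bool) (eJ : Fin (π.R + 1) → Bool) (w w' : Fin π.M → Bool)

/-- The point `join` is `toK ∘ join`. [folklore] -/
theorem pt_join : pt (k := k) π (join π eA eJ w w') = toK k ∘ join π eA eJ w w' := rfl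

/-- `IND` at a Boolean point. [folklore] -/
theorem eval_IND (ℓα ℓj : ℕ) : eval (pt π (join π eA eJ w w')) (IND (k := k) π ℓα ℓj) =
    toK k (decide (Nat.size (Nat.ofBits eA) = ℓα)) * toK k (decide (Nat.size (Nat.ofBits eJ) = ℓj)) *
      toK k (decide (Nat.ofBits eA < 2 ^ π.P)) * toK k (decide (Nat.ofBits eJ ≠ 0)) * toK k (decide (Nat.ofBits eJ ≤ 2 ^ π.R)) := by
  unfold IND
  rw [map_mul, map_mul, map_mul, map_mul,
    eval_lenInd (EAv π) _ eA (fun t => eval_EAv π eA eJ w w' t),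
    eval_lenInd (EJv π) _ eJ (fun t => eval_EJv π eA eJ w w' t),
    eval_allZeroFrom (EAv π) _ eA (fun t => eval_EAv π eA eJ w w' t),
    eval_jnzInd (EJv π) _ eJ (fun t => eval_EJv π eA eJ w w' t),
    eval_jleInd _ (EJv π) eJ (fun t => eval_EJv π eA eJ w w' t)]

/-- The transcript assignment read off the block `w`. [folklore] -/
def yOf {s : ℕ} (w : Fin π.M → Bool) : Fin s → Bool := fun m => if h : m.val < π.M then w ⟨m.val, h⟩ else false

/-- `eval x (bind₁ h φ) = eval (eval x ∘ h) φ`. [folklore] -/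
theorem eval_bind₁' {σ τ : Type*} (x : τ → k) (h : σ → MvPolynomial τ k) (φ : MvPolynomial σ k) :
    eval x (bind₁ h φ) = eval (fun i => eval x (h i)) φ :=
  eval₂Hom_bind₁ _ _ _ _

/-- The substitution `σb` at a Boolean point is the Boolean point `(word, transcript)`. [folklore] -/
theorem eval_σb (ℓα ℓj : ℕ) :
    (fun v => eval (pt π (join π eA eJ w w')) (σb (k := k) π ℓα ℓj v)) =
      bpt k (wfun π ℓα ℓj eA eJ) (yOf π w) := by
  funext v
  cases v with
  | inl q =>
    simp only [σb, Sum.elim_inl, bpt, Function.comp_apply, wfun]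
    have h := congrArg (fun l => l.getD q.val (0 : k)) (map_eval_wpoly (k := k) π ℓα ℓj eA eJ w w')
    rw [show (0 : k) = eval (pt π (join π eA eJ w w')) 0 from (map_zero _).symm, List.getD_map] at h
    rw [h, show eval (pt π (join π eA eJ w w')) (0 : MvPolynomial (BV π) k) = toK k false by simp,
      List.getD_map]
  | inr m =>
    simp only [σb, Sum.elim_inr, bpt, Function.comp_apply, yOf]
    split <;> simp

/-- The substitution `σs` at a Boolean point. [folklore] -/
theorem eval_σs (ℓα : ℕ) :
    (fun v => eval (pt π (join π eA eJ w w')) (σs (k := k) π ℓα v)) =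
      bpt k (wfun π ℓα 0 eA eJ) (yOf π w') := by
  funext v
  cases v with
  | inl q =>
    simp only [σs, Sum.elim_inl, bpt, Function.comp_apply, wfun]
    have h := congrArg (fun l => l.getD q.val (0 : k)) (map_eval_wpoly (k := k) π ℓα 0 eA eJ w w')
    rw [show (0 : k) = eval (pt π (join π eA eJ w w')) 0 from (map_zero _).symm, List.getD_map] at h
    rw [h, show eval (pt π (join π eA eJ w w')) (0 : MvPolynomial (BV π) k) = toK k false by simp,
      List.getD_map]
  | inr m =>
    simp only [σs, Sum.elim_inr, bpt, Function.comp_apply, yOf]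
    split <;> simp

/-- `BIT` at a Boolean point. [folklore] -/
theorem eval_BIT (ℓα ℓj : ℕ) : eval (pt π (join π eA eJ w w')) (BIT (k := k) π ℓα ℓj) =
    eval (bpt k (wfun π ℓα ℓj eA eJ) (yOf π w)) (arith (Qw π ℓα ℓj)) := by
  rw [BIT, eval_bind₁', eval_σb]

/-- `SGN` at a Boolean point. [folklore] -/
theorem eval_SGN (ℓα : ℕ) : eval (pt π (join π eA eJ w w')) (SGN (k := k) π ℓα) =
    eval (bpt k (wfun π ℓα 0 eA eJ) (yOf π w')) (sgnArith (Qw π ℓα 0)) := by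
  rw [SGN, eval_bind₁', eval_σs]

/-- Summing over the block `w` is summing over transcripts (in range, where the size is `M`). [folklore] -/
theorem sum_yOf {s : ℕ} (hs : s = π.M) (F : (Fin s → Bool) → k) :
    ∑ w : Fin π.M → Bool, F (yOf π w) = ∑ y : Fin s → Bool, F y := by
  subst hs
  refine Finset.sum_congr rfl fun w _ => ?_
  congr 1
  funext m
  simp [yOf, m.isLt]

/-- **The transcript sum of the bit gadget**: `∑_w BIT = [C_L(word)]`. [cite: Tavenas2014, proof of Prop. 3.17] -/
theorem sum_eval_BIT {ℓα ℓj : ℕ} (hℓα : ℓα ≤ π.D) (hℓj : ℓj ≤ π.R + 1) :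
    ∑ w : Fin π.M → Bool, eval (pt π (join π eA eJ w w')) (BIT (k := k) π ℓα ℓj) =
      toK k ((π.CF (L π ℓα ℓj)).eval (wfun π ℓα ℓj eA eJ)) := by
  simp only [eval_BIT]
  rw [sum_yOf π (size_Qw π hℓα hℓj) (fun y => eval (bpt k (wfun π ℓα ℓj eA eJ) y) (arith (Qw π ℓα ℓj))),
    sum_eval_arith _ (isOver_Qw π ℓα ℓj), Qw, Circuit.eval_padTo]

/-- **The transcript sum of the sign gadget**: `∑_{w'} SGN = 1 - 2 [C_{L₀}(word₀)]`. [cite: Tavenas2014, proof of Prop. 3.17] -/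
theorem sum_eval_SGN {ℓα : ℕ} (hℓα : ℓα ≤ π.D) :
    ∑ w' : Fin π.M → Bool, eval (pt π (join π eA eJ w w')) (SGN (k := k) π ℓα) =
      1 - 2 * toK k ((π.CF (L π ℓα 0)).eval (wfun π ℓα 0 eA eJ)) := by
  simp only [eval_SGN]
  rw [sum_yOf π (size_Qw π hℓα (Nat.zero_le _)) (fun y => eval (bpt k (wfun π ℓα 0 eA eJ) y) (sgnArith (Qw π ℓα 0))),
    sum_eval_sgnArith _ (isOver_Qw π ℓα 0), Qw, Circuit.eval_padTo]

end Values

/-! ### The Boolean sum of the witness -/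

/-- Splitting an assignment of the Boolean variables into its four blocks. [folklore] -/
def splitE : (BV π → Bool) ≃ (Fin π.D → Bool) × ((Fin (π.R + 1) → Bool) × ((Fin π.M → Bool) × (Fin π.M → Bool))) :=
  (Equiv.sumArrowEquivProdArrow _ _ _).trans (Equiv.prodCongr (Equiv.refl _)
    ((Equiv.sumArrowEquivProdArrow _ _ _).trans (Equiv.prodCongr (Equiv.refl _) (Equiv.sumArrowEquivProdArrow _ _ _))))

/-- The inverse of the splitting is `join`. [folklore] -/
theorem splitE_symm_apply (p : (Fin π.D → Bool) × ((Fin (π.R + 1) → Bool) × ((Fin π.M → Bool) × (Fin π.M → Bool)))) :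
    (splitE π).symm p = join π p.1 p.2.1 p.2.2.1 p.2.2.2 := by
  rfl

/-- **Summing over all Boolean assignments block by block.** [folklore] -/
theorem sum_BV {A : Type*} [AddCommMonoid A] (F : (BV π → Bool) → A) :
    ∑ e : BV π → Bool, F e = ∑ eA : Fin π.D → Bool, ∑ eJ : Fin (π.R + 1) → Bool,
      ∑ w : Fin π.M → Bool, ∑ w' : Fin π.M → Bool, F (join π eA eJ w w') := by
  rw [← Fintype.sum_equiv (splitE π).symm (fun p => F ((splitE π).symm p)) F (fun _ => rfl),
    Fintype.sum_prod_type]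
  refine Finset.sum_congr rfl fun eA _ => ?_
  rw [Fintype.sum_prod_type]
  refine Finset.sum_congr rfl fun eJ _ => ?_
  rw [Fintype.sum_prod_type]
  rfl

/-- `SC` at a Boolean point, summed over the two transcript blocks. [cite: Tavenas2014, proof of Prop. 3.17] -/
theorem sum_sum_eval_SC (eA : Fin π.D → Bool) (eJ : Fin (π.R + 1) → Bool) :
    ∑ w : Fin π.M → Bool, ∑ w' : Fin π.M → Bool, eval (pt π (join π eA eJ w w')) (SC (k := k) π) =
      ∑ ℓα ∈ Finset.range (π.D + 1), ∑ ℓj ∈ Finset.range (π.R + 2),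
        (toK k (decide (Nat.size (Nat.ofBits eA) = ℓα)) * toK k (decide (Nat.size (Nat.ofBits eJ) = ℓj)) *
          toK k (decide (Nat.ofBits eA < 2 ^ π.P)) * toK k (decide (Nat.ofBits eJ ≠ 0)) * toK k (decide (Nat.ofBits eJ ≤ 2 ^ π.R))) *
        (toK k ((π.CF (L π ℓα ℓj)).eval (wfun π ℓα ℓj eA eJ)) *
          (1 - 2 * toK k ((π.CF (L π ℓα 0)).eval (wfun π ℓα 0 eA eJ)))) := by
  -- expand `SC` and `SCAL`
  have hexp : ∀ w w' : Fin π.M → Bool, eval (pt π (join π eA eJ w w')) (SC (k := k) π) =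
      ∑ ℓα ∈ Finset.range (π.D + 1), ∑ ℓj ∈ Finset.range (π.R + 2),
        eval (pt π (join π eA eJ w w')) (IND (k := k) π ℓα ℓj) *
          (eval (pt π (join π eA eJ w w')) (BIT (k := k) π ℓα ℓj) * eval (pt π (join π eA eJ w w')) (SGN (k := k) π ℓα)) := by
    intro w w'
    unfold SC SCAL
    rw [map_sum]
    refine Finset.sum_congr rfl fun ℓα _ => ?_
    rw [map_sum]
    refine Finset.sum_congr rfl fun ℓj _ => ?_
    rw [map_mul, map_mul, mul_assoc]
  simp only [hexp]
  -- swap the sums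
  rw [Finset.sum_comm]
  simp only [Finset.sum_comm (s := (Finset.univ : Finset (Fin π.M → Bool))) (t := Finset.range (π.D + 1))]
  refine Finset.sum_congr rfl fun ℓα hℓα => ?_
  rw [Finset.sum_comm]
  simp only [Finset.sum_comm (s := (Finset.univ : Finset (Fin π.M → Bool))) (t := Finset.range (π.R + 2))]
  refine Finset.sum_congr rfl fun ℓj hℓj => ?_
  have hℓα' : ℓα ≤ π.D := by rw [Finset.mem_range] at hℓα; omega
  have hℓj' : ℓj ≤ π.R + 1 := by rw [Finset.mem_range] at hℓj; omega
  -- the indicator does not depend on the transcript blocks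
  simp only [eval_IND, ← Finset.mul_sum]
  congr 1
  -- factor the two transcript sums
  have hfac : ∀ w : Fin π.M → Bool,
      ∑ w' : Fin π.M → Bool, eval (pt π (join π eA eJ w w')) (BIT (k := k) π ℓα ℓj) *
        eval (pt π (join π eA eJ w w')) (SGN (k := k) π ℓα) =
      eval (bpt k (wfun π ℓα ℓj eA eJ) (yOf π w)) (arith (Qw π ℓα ℓj)) *
        (1 - 2 * toK k ((π.CF (L π ℓα 0)).eval (wfun π ℓα 0 eA eJ))) := by
    intro w
    simp only [eval_BIT]
    rw [← Finset.mul_sum, sum_eval_SGN π eA eJ w hℓα']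
  simp only [hfac]
  rw [← Finset.sum_mul]
  congr 1
  have := sum_eval_BIT (k := k) π eA eJ (fun _ => false) hℓα' hℓj'
  simp only [eval_BIT] at this
  exact this

/-- The circuit's value on a list word. [folklore] -/
theorem eval_CF_list (x : List Bool) {ℓ : ℕ} (h : x.length = ℓ) :
    (π.CF ℓ).eval (fun q : Fin ℓ => x.getD q false) = (π.CF x.length).eval x.get := by
  subst h
  congr 1
  funext q
  exact List.getD_eq_getElem _ _ q.isLt

/-- In range, the bit query reads the membership bit of Tavenas' word. [cite: Tavenas2014, proof of Prop. 3.17] -/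
theorem eval_CF_wfun (mem : List Bool → Bool) (hdec : ∀ x : List Bool, (π.CF x.length).eval x.get = mem x)
    (eA : Fin π.D → Bool) (eJ : Fin (π.R + 1) → Bool) (hD : Nat.size (Nat.ofBits eA) ≤ π.D) (hR : Nat.size (Nat.ofBits eJ) ≤ π.R + 1) :
    (π.CF (L π (Nat.size (Nat.ofBits eA)) (Nat.size (Nat.ofBits eJ)))).eval (wfun π (Nat.size (Nat.ofBits eA)) (Nat.size (Nat.ofBits eJ)) eA eJ) =
      mem (encUQuery π.N (Nat.ofBits eA) (Nat.ofBits eJ)) := by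
  unfold wfun
  rw [eval_CF_list π _ (length_wbits π _ _ eA eJ), wbits_eq_encUQuery π hD hR eA eJ rfl rfl, hdec]

/-- The sign query word does not depend on the `j`-bits. [folklore] -/
theorem wbits_zero (ℓα : ℕ) (eA : Fin π.D → Bool) (eJ eJ' : Fin (π.R + 1) → Bool) :
    wbits π ℓα 0 eA eJ = wbits π ℓα 0 eA eJ' := by
  simp [wbits]

/-- In range, the sign query reads the membership bit of `(1^N # α, 0)`. [cite: Tavenas2014, proof of Prop. 3.17] -/
theorem eval_CF_wfun_zero (mem : List Bool → Bool) (hdec : ∀ x : List Bool, (π.CF x.length).eval x.get = mem x)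
    (eA : Fin π.D → Bool) (eJ : Fin (π.R + 1) → Bool) (hD : Nat.size (Nat.ofBits eA) ≤ π.D) :
    (π.CF (L π (Nat.size (Nat.ofBits eA)) 0)).eval (wfun π (Nat.size (Nat.ofBits eA)) 0 eA eJ) = mem (encUQuery π.N (Nat.ofBits eA) 0) := by
  unfold wfun
  rw [eval_CF_list π _ (length_wbits π _ _ eA eJ), wbits_zero π _ eA eJ (fun _ => false),
    wbits_eq_encUQuery π hD (Nat.zero_le _) eA (fun _ => false) rfl ?_, hdec]
  · congr 2
    exact (ofBits_eq_zero_iff _).2 fun _ => rfl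
  · rw [(ofBits_eq_zero_iff _).2 fun _ => rfl]; rfl

/-- **The length double sum has a single nonzero term.** [folklore] -/
theorem sum_lengths_eq (eA : Fin π.D → Bool) (eJ : Fin (π.R + 1) → Bool) (K₁ K₂ K₃ : k) (V : ℕ → ℕ → k) :
    ∑ ℓα ∈ Finset.range (π.D + 1), ∑ ℓj ∈ Finset.range (π.R + 2),
      (toK k (decide (Nat.size (Nat.ofBits eA) = ℓα)) * toK k (decide (Nat.size (Nat.ofBits eJ) = ℓj)) * K₁ * K₂ * K₃) * V ℓα ℓj =
      K₁ * K₂ * K₃ * V (Nat.size (Nat.ofBits eA)) (Nat.size (Nat.ofBits eJ)) := by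
  have hD : Nat.size (Nat.ofBits eA) ≤ π.D := Nat.size_le.2 (Nat.ofBits_lt_two_pow eA)
  have hR : Nat.size (Nat.ofBits eJ) ≤ π.R + 1 := Nat.size_le.2 (Nat.ofBits_lt_two_pow eJ)
  rw [Finset.sum_eq_single (Nat.size (Nat.ofBits eA))]
  · rw [Finset.sum_eq_single (Nat.size (Nat.ofBits eJ))]
    · simp [toK]
    · intro ℓj _ hne
      rw [decide_eq_false (Ne.symm hne)]; simp [toK]
    · intro h; exact absurd (Finset.mem_range.2 (by omega)) h
  · intro ℓα _ hne
    refine Finset.sum_eq_zero fun ℓj _ => ?_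
    rw [decide_eq_false (Ne.symm hne)]; simp [toK]
  · intro h; exact absurd (Finset.mem_range.2 (by omega)) h

/-- **The Boolean sum of the witness, second form**: per `(α, j)`-assignment. [cite: Tavenas2014, proof of Prop. 3.17] -/
theorem bsum_gW_eq_sum₂ (mem : List Bool → Bool) (hdec : ∀ x : List Bool, (π.CF x.length).eval x.get = mem x) :
    bsum (gW (k := k) π) = ∑ eA : Fin π.D → Bool, ∑ eJ : Fin (π.R + 1) → Bool,
      C (toK k (decide (Nat.ofBits eA < 2 ^ π.P)) * toK k (decide (Nat.ofBits eJ ≠ 0)) * toK k (decide (Nat.ofBits eJ ≤ 2 ^ π.R)) *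
        (toK k (mem (encUQuery π.N (Nat.ofBits eA) (Nat.ofBits eJ))) * (1 - 2 * toK k (mem (encUQuery π.N (Nat.ofBits eA) 0))))) *
      xsel π eA * zsel π (dvec π eJ) := by
  rw [bsum_gW_eq_sum, sum_BV]
  refine Finset.sum_congr rfl fun eA _ => Finset.sum_congr rfl fun eJ _ => ?_
  have hD : Nat.size (Nat.ofBits eA) ≤ π.D := Nat.size_le.2 (Nat.ofBits_lt_two_pow eA)
  have hR : Nat.size (Nat.ofBits eJ) ≤ π.R + 1 := Nat.size_le.2 (Nat.ofBits_lt_two_pow eJ)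
  -- the selectors do not depend on the transcript blocks
  have hsel : ∀ w w' : Fin π.M → Bool,
      C (eval (toK k ∘ join π eA eJ w w') (SC (k := k) π)) * xsel (k := k) π (join π eA eJ w w' ∘ Sum.inl) *
        zsel π (dvec π fun t => join π eA eJ w w' (Sum.inr (Sum.inl t))) =
      C (eval (pt π (join π eA eJ w w')) (SC (k := k) π)) * (xsel π eA * zsel π (dvec π eJ)) := by
    intro w w'; rw [mul_assoc]; rfl
  simp only [hsel, ← Finset.sum_mul]
  rw [mul_assoc (C _) (xsel π eA) (zsel π (dvec π eJ))]
  congr 1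
  simp only [← map_sum]
  congr 1
  rw [sum_sum_eval_SC, sum_lengths_eq π eA eJ _ _ _ (fun ℓα ℓj => toK k ((π.CF (L π ℓα ℓj)).eval (wfun π ℓα ℓj eA eJ)) *
    (1 - 2 * toK k ((π.CF (L π ℓα 0)).eval (wfun π ℓα 0 eA eJ)))),
    eval_CF_wfun π mem hdec eA eJ hD hR, eval_CF_wfun_zero π mem hdec eA eJ hD]

/-! ### Reindexing the bit position: `j ↦ i = j - 1` -/

/-- Sums over a range vanishing beyond a smaller range. [folklore] -/
theorem sum_range_of_eq_zero {A : Type*} [AddCommMonoid A] {m n : ℕ} (h : n ≤ m) (f : ℕ → A)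
    (hf : ∀ i, n ≤ i → f i = 0) : ∑ i ∈ Finset.range m, f i = ∑ i ∈ Finset.range n, f i := by
  symm
  apply Finset.sum_subset (Finset.range_subset_range.2 h)
  intro i _ hi
  exact hf i (by simpa using hi)

/-- **The Boolean sum of the witness, final form**: `∑_{α-bits} ∑_{i-bits} [α < 2^P] · [q(α, i+1) ∈ B] ·
(1 - 2 [q(α, 0) ∈ B]) · x^α z^i`. [cite: Tavenas2014, proof of Prop. 3.17, (3.1)] -/
theorem bsum_gW_eq (mem : List Bool → Bool) (hdec : ∀ x : List Bool, (π.CF x.length).eval x.get = mem x) :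
    bsum (gW (k := k) π) = ∑ eA : Fin π.D → Bool, ∑ eI : Fin π.R → Bool,
      C (toK k (decide (Nat.ofBits eA < 2 ^ π.P)) *
        (toK k (mem (encUQuery π.N (Nat.ofBits eA) (Nat.ofBits eI + 1))) * (1 - 2 * toK k (mem (encUQuery π.N (Nat.ofBits eA) 0))))) *
      xsel π eA * zsel π eI := by
  rw [bsum_gW_eq_sum₂ π mem hdec]
  refine Finset.sum_congr rfl fun eA _ => ?_
  set a : k := toK k (decide (Nat.ofBits eA < 2 ^ π.P)) with ha
  set sg : k := 1 - 2 * toK k (mem (encUQuery π.N (Nat.ofBits eA) 0)) with hsg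
  -- the summand as a function of `j = Nat.ofBits eJ`
  set Φ : ℕ → MvPolynomial (XZ π) k := fun j =>
    if 1 ≤ j ∧ j ≤ 2 ^ π.R then
      C (a * (toK k (mem (encUQuery π.N (Nat.ofBits eA) j)) * sg)) * xsel π eA * zsel π (fun t : Fin π.R => (j - 1).testBit t)
    else 0 with hΦ
  have h1 : ∀ eJ : Fin (π.R + 1) → Bool,
      C (a * toK k (decide (Nat.ofBits eJ ≠ 0)) * toK k (decide (Nat.ofBits eJ ≤ 2 ^ π.R)) *
        (toK k (mem (encUQuery π.N (Nat.ofBits eA) (Nat.ofBits eJ))) * sg)) * xsel π eA * zsel π (dvec π eJ) = Φ (Nat.ofBits eJ) := by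
    intro eJ
    simp only [hΦ]
    by_cases hc : 1 ≤ Nat.ofBits eJ ∧ Nat.ofBits eJ ≤ 2 ^ π.R
    · rw [if_pos hc, decide_eq_true (show Nat.ofBits eJ ≠ 0 by omega), decide_eq_true hc.2, toK_true, mul_one, mul_one]
      congr 2
      funext t
      exact decVec_eq_testBit eJ hc.1 t.castSucc
    · rw [if_neg hc]
      have h0 : a * toK k (decide (Nat.ofBits eJ ≠ 0)) * toK k (decide (Nat.ofBits eJ ≤ 2 ^ π.R)) = 0 := by
        by_cases hz : Nat.ofBits eJ = 0
        · rw [decide_eq_false (show ¬ Nat.ofBits eJ ≠ 0 from fun h => h hz)]; simp [toK]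
        · rw [decide_eq_false (show ¬ Nat.ofBits eJ ≤ 2 ^ π.R by omega)]; simp [toK]
      rw [h0, zero_mul, C_0, zero_mul, zero_mul]
  simp only [h1]
  rw [sum_boolVec_eq_sum_range Φ]
  -- drop `j = 0` and `j > 2^R`
  have hsplit : 2 ^ (π.R + 1) = (2 ^ (π.R + 1) - 1) + 1 := by
    have := Nat.one_le_two_pow (n := π.R + 1); omega
  rw [hsplit, Finset.sum_range_succ', show Φ 0 = 0 by simp [hΦ], add_zero,
    sum_range_of_eq_zero (show 2 ^ π.R ≤ 2 ^ (π.R + 1) - 1 by rw [pow_succ]; have := Nat.one_le_two_pow (n := π.R); omega)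
      (fun i => Φ (i + 1)) (fun i hi => by simp only [hΦ]; rw [if_neg (by omega)]),
    ← sum_boolVec_eq_sum_range (fun i => Φ (i + 1))]
  refine Finset.sum_congr rfl fun eI _ => ?_
  simp only [hΦ]
  rw [if_pos ⟨by omega, Nat.ofBits_lt_two_pow eI⟩, Nat.add_sub_cancel]
  congr 2
  funext t
  exact Nat.testBit_ofBits_lt eI t.val t.isLt

/-! ### Substitutions by variables and constants (projections) -/

section Degree

variable {R : Type*} [CommSemiring R]

/-- **A substitution by polynomials of degree `≤ 1` does not increase the degree.** [folklore] -/
theorem totalDegree_bind₁_le {σ τ : Type*} {h : σ → MvPolynomial τ R} (hh : ∀ v, (h v).totalDegree ≤ 1)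
    (p : MvPolynomial σ R) : (bind₁ h p).totalDegree ≤ p.totalDegree := by
  classical
  conv_lhs => rw [p.as_sum, map_sum]
  refine (totalDegree_finsetSum _ _).trans (Finset.sup_le fun m hm => ?_)
  rw [bind₁_monomial]
  refine (totalDegree_mul _ _).trans ?_
  rw [totalDegree_C, zero_add]
  change (∏ v ∈ m.support, h v ^ m v).totalDegree ≤ _
  refine (totalDegree_finsetProd _ _).trans ?_
  calc ∑ v ∈ m.support, (h v ^ m v).totalDegree ≤ ∑ v ∈ m.support, m v := Finset.sum_le_sum fun v _ =>
        (totalDegree_pow _ _).trans (by have := hh v; nlinarith)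
    _ = m.sum fun _ e => e := rfl
    _ ≤ p.totalDegree := le_totalDegree hm

/-- **Discharge of the named fact `IsProjection.totalDegree_le`** (`ValiantClasses.lean`;
Bürgisser 2000, §2.1): a projection does not increase the total degree (variables and constants
have degree `≤ 1`, `totalDegree_bind₁_le`). [cite: Burgisser2000, §2.1] -/
theorem IsProjection.totalDegree_le_holds {σ τ : Type*} : IsProjection.totalDegree_le (k := R) (σ := σ) (τ := τ) := by
  intro g f h
  obtain ⟨a, ha, rfl⟩ := h
  rw [aeval_eq_bind₁]
  refine totalDegree_bind₁_le (fun v => ?_) f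
  rcases ha v with ⟨j, hj⟩ | ⟨c, hc⟩
  · rw [hj]; exact (isHomogeneous_X R j).totalDegree_le
  · rw [hc, totalDegree_C]; exact Nat.zero_le _

end Degree

/-- `p` is a variable or a constant. [cite: Burgisser2000, Def. 2.6(1)] -/
def IsVarOrConst {σ : Type*} (p : MvPolynomial σ k) : Prop := (∃ j, p = X j) ∨ ∃ c, p = C c

/-- A substitution by variables and constants is a projection. [cite: Burgisser2000, Def. 2.6(1)] -/
theorem isProjection_bind₁ {σ τ : Type*} {h : σ → MvPolynomial τ k} (hh : ∀ v, IsVarOrConst (h v)) (p : MvPolynomial σ k) :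
    IsProjection (bind₁ h p) p :=
  ⟨h, hh, by rw [aeval_eq_bind₁]⟩

/-- The entries of the generic word are its distinguished symbols or entries of `la, lj`. [folklore] -/
theorem mem_wordG {γ : Type*} {tt ff : γ} {N : ℕ} {la lj : List γ} {a : γ} (h : a ∈ wordG tt ff N la lj) :
    a = tt ∨ a = ff ∨ a ∈ la ∨ a ∈ lj := by
  simp only [wordG, dup2, List.mem_append, List.mem_flatMap, List.mem_replicate, List.mem_cons,
    List.not_mem_nil, or_false] at h
  rcases h with ((((⟨b, ⟨-, rfl⟩, hb⟩ | h) | ⟨b, hb, hb'⟩) | h) | h)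
  · rcases hb with rfl | rfl <;> exact Or.inl rfl
  · rcases h with rfl | rfl
    · exact Or.inr (Or.inl rfl)
    · exact Or.inl rfl
  · rcases hb' with rfl | rfl <;> exact Or.inr (Or.inr (Or.inl hb))
  · rcases h with rfl | rfl
    · exact Or.inr (Or.inl rfl)
    · exact Or.inl rfl
  · exact Or.inr (Or.inr (Or.inr h))

/-- `EA'` is a variable or a constant. [folklore] -/
theorem isVarOrConst_EA' (t : ℕ) : IsVarOrConst (EA' (k := k) π t) := by
  unfold EA' EAv; split
  · exact Or.inl ⟨_, rfl⟩
  · exact Or.inr ⟨0, C_0.symm⟩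

/-- `EJ'` is a variable or a constant. [folklore] -/
theorem isVarOrConst_EJ' (t : ℕ) : IsVarOrConst (EJ' (k := k) π t) := by
  unfold EJ' EJv; split
  · exact Or.inl ⟨_, rfl⟩
  · exact Or.inr ⟨0, C_0.symm⟩

/-- The entries of the polynomial word are variables or constants. [folklore] -/
theorem isVarOrConst_wpoly_getD (ℓα ℓj q : ℕ) : IsVarOrConst ((wpoly (k := k) π ℓα ℓj).getD q 0) := by
  rw [List.getD_eq_getElem?_getD]
  cases hq : (wpoly (k := k) π ℓα ℓj)[q]? with
  | none => exact Or.inr ⟨0, by simp⟩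
  | some a =>
    simp only [Option.getD_some]
    have hmem : a ∈ wpoly (k := k) π ℓα ℓj := List.mem_of_getElem? hq
    rcases mem_wordG hmem with rfl | rfl | h | h
    · exact Or.inr ⟨1, C_1.symm⟩
    · exact Or.inr ⟨0, C_0.symm⟩
    · simp only [List.mem_ofFn] at h
      obtain ⟨t, rfl⟩ := h
      exact isVarOrConst_EA' π _
    · simp only [List.mem_ofFn] at h
      obtain ⟨t, rfl⟩ := h
      exact isVarOrConst_EJ' π _

/-- `σb` substitutes variables and constants. [folklore] -/
theorem isVarOrConst_σb (ℓα ℓj : ℕ) (v) : IsVarOrConst (σb (k := k) π ℓα ℓj v) := by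
  cases v with
  | inl q => exact isVarOrConst_wpoly_getD π ℓα ℓj q
  | inr m =>
    simp only [σb, Sum.elim_inr]
    split
    · exact Or.inl ⟨_, rfl⟩
    · exact Or.inr ⟨0, C_0.symm⟩

/-- `σs` substitutes variables and constants. [folklore] -/
theorem isVarOrConst_σs (ℓα : ℕ) (v) : IsVarOrConst (σs (k := k) π ℓα v) := by
  cases v with
  | inl q => exact isVarOrConst_wpoly_getD π ℓα 0 q
  | inr m =>
    simp only [σs, Sum.elim_inr]
    split
    · exact Or.inl ⟨_, rfl⟩
    · exact Or.inr ⟨0, C_0.symm⟩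

/-- Variables and constants have degree `≤ 1`. [folklore] -/
theorem IsVarOrConst.totalDegree_le {σ : Type*} {p : MvPolynomial σ k} (h : IsVarOrConst p) : p.totalDegree ≤ 1 := by
  rcases h with ⟨j, rfl⟩ | ⟨c, rfl⟩
  · exact totalDegree_X_le_one' (k := k) j
  · rw [totalDegree_C]; exact Nat.zero_le _

/-! ### Size and degree of the witness -/

/-- `L(BIT) ≤ 60 M + 1` (in range). [cite: Burgisser2000, Prop. 2.20 (g ∈ VP)] -/
theorem complexity_BIT_le {ℓα ℓj : ℕ} (hℓα : ℓα ≤ π.D) (hℓj : ℓj ≤ π.R + 1) :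
    complexity (BIT (k := k) π ℓα ℓj) ≤ 60 * π.M + 1 := by
  unfold BIT
  refine (IsProjection.complexity_le_holds (isProjection_bind₁ (isVarOrConst_σb π ℓα ℓj) _)).trans ?_
  rw [← size_Qw π hℓα hℓj]
  exact complexity_arith_le _

/-- `L(SGN) ≤ 60 M + 5` (in range). [cite: Burgisser2000, Prop. 2.20 (g ∈ VP)] -/
theorem complexity_SGN_le {ℓα : ℕ} (hℓα : ℓα ≤ π.D) : complexity (SGN (k := k) π ℓα) ≤ 60 * π.M + 5 := by
  unfold SGN
  refine (IsProjection.complexity_le_holds (isProjection_bind₁ (isVarOrConst_σs π ℓα) _)).trans ?_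
  rw [← size_Qw π hℓα (Nat.zero_le _)]
  exact complexity_sgnArith_le _

/-- `L(IND) ≤ 6D + 9R + 18`. [cite: Burgisser2000, Def. 2.1] -/
theorem complexity_IND_le (ℓα ℓj : ℕ) : complexity (IND (k := k) π ℓα ℓj) ≤ 6 * π.D + 9 * π.R + 18 := by
  unfold IND
  have hA0 : ∀ t, complexity (EAv (k := k) π t) = 0 := fun t => complexity_X_holds _
  have hJ0 : ∀ t, complexity (EJv (k := k) π t) = 0 := fun t => complexity_X_holds _
  have h1 := complexity_lenInd_le (EAv (k := k) π) hA0 ℓα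
  have h2 := complexity_lenInd_le (EJv (k := k) π) hJ0 ℓj
  have h3 := complexity_allZeroFrom_le (EAv (k := k) π) hA0 π.P
  have h4 := complexity_jnzInd_le (EJv (k := k) π) hJ0
  have h5 := complexity_jleInd_le (EJv (k := k) π) hJ0
  have m1 := complexity_mul_le_holds (lenInd (EAv (k := k) π) ℓα) (lenInd (EJv π) ℓj)
  have m2 := complexity_mul_le_holds (lenInd (EAv (k := k) π) ℓα * lenInd (EJv π) ℓj) (allZeroFrom (EAv π) π.P)
  have m3 := complexity_mul_le_holds (lenInd (EAv (k := k) π) ℓα * lenInd (EJv π) ℓj * allZeroFrom (EAv π) π.P) (jnzInd (EJv π))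
  have m4 := complexity_mul_le_holds (lenInd (EAv (k := k) π) ℓα * lenInd (EJv π) ℓj * allZeroFrom (EAv π) π.P * jnzInd (EJv π))
    (jleInd (EJv π))
  omega

/-- The cost of one scalar gadget. [folklore] -/
def scalCost (D R M : ℕ) : ℕ := 6 * D + 9 * R + 120 * M + 26

/-- `L(SCAL) ≤ scalCost` (in range). [cite: Burgisser2000, Prop. 2.20 (g ∈ VP)] -/
theorem complexity_SCAL_le {ℓα ℓj : ℕ} (hℓα : ℓα ≤ π.D) (hℓj : ℓj ≤ π.R + 1) :
    complexity (SCAL (k := k) π ℓα ℓj) ≤ scalCost π.D π.R π.M := by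
  unfold SCAL scalCost
  have h1 := complexity_IND_le (k := k) π ℓα ℓj
  have h2 := complexity_BIT_le (k := k) π hℓα hℓj
  have h3 := complexity_SGN_le (k := k) π hℓα
  have m1 := complexity_mul_le_holds (IND (k := k) π ℓα ℓj) (BIT π ℓα ℓj)
  have m2 := complexity_mul_le_holds (IND (k := k) π ℓα ℓj * BIT π ℓα ℓj) (SGN π ℓα)
  omega

/-- `L(SC) ≤ (D+1)((R+2)(scalCost + 1) + 1)`. [cite: Burgisser2000, Prop. 2.20 (g ∈ VP)] -/
theorem complexity_SC_le : complexity (SC (k := k) π) ≤ (π.D + 1) * ((π.R + 2) * (scalCost π.D π.R π.M + 1) + 1) := by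
  unfold SC
  refine (complexity_finset_sum_le _ _).trans ?_
  have hin : ∀ ℓα ∈ Finset.range (π.D + 1), complexity (∑ ℓj ∈ Finset.range (π.R + 2), SCAL (k := k) π ℓα ℓj) ≤
      (π.R + 2) * (scalCost π.D π.R π.M + 1) := by
    intro ℓα hℓα
    refine (complexity_finset_sum_le _ _).trans ?_
    calc ∑ ℓj ∈ Finset.range (π.R + 2), complexity (SCAL (k := k) π ℓα ℓj) + (Finset.range (π.R + 2)).card
        ≤ ∑ _ℓj ∈ Finset.range (π.R + 2), scalCost π.D π.R π.M + (Finset.range (π.R + 2)).card :=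
          Nat.add_le_add_right (Finset.sum_le_sum fun ℓj hℓj => complexity_SCAL_le π
            (by rw [Finset.mem_range] at hℓα; omega) (by rw [Finset.mem_range] at hℓj; omega)) _
      _ = (π.R + 2) * (scalCost π.D π.R π.M + 1) := by rw [Finset.sum_const, Finset.card_range, smul_eq_mul]; ring
  calc ∑ ℓα ∈ Finset.range (π.D + 1), complexity (∑ ℓj ∈ Finset.range (π.R + 2), SCAL (k := k) π ℓα ℓj) +
        (Finset.range (π.D + 1)).card
      ≤ ∑ _ℓα ∈ Finset.range (π.D + 1), (π.R + 2) * (scalCost π.D π.R π.M + 1) + (Finset.range (π.D + 1)).card :=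
        Nat.add_le_add_right (Finset.sum_le_sum hin) _
    _ = (π.D + 1) * ((π.R + 2) * (scalCost π.D π.R π.M + 1) + 1) := by
        rw [Finset.sum_const, Finset.card_range, smul_eq_mul]; ring

/-- `L(XMON) ≤ 5D`. [cite: Burgisser2000, Def. 2.1] -/
theorem complexity_XMON_le : complexity (XMON (k := k) π) ≤ 5 * π.D := by
  unfold XMON
  refine (complexity_selProd_le _ _).trans (le_of_eq ?_)
  rw [Finset.sum_eq_zero fun t _ => by rw [complexity_X_holds, complexity_X_holds]; rfl, zero_add]

/-- `L(ZMON) ≤ R (12 R + 24) + 5 R`. [cite: Burgisser2000, Def. 2.1] -/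
theorem complexity_ZMON_le : complexity (ZMON (k := k) π) ≤ π.R * (12 * π.R + 24) + 5 * π.R := by
  unfold ZMON
  refine (complexity_selProd_le _ _).trans (Nat.add_le_add_right ?_ _)
  have hJ0 : ∀ t, complexity (EJv (k := k) π t) = 0 := fun t => complexity_X_holds _
  calc ∑ t : Fin π.R, (2 * complexity (rename Sum.inr (decBit (EJv (k := k) π) t.castSucc) : MvPolynomial (XZ π ⊕ BV π) k) +
        complexity (X (Sum.inl (Sum.inr t)) : MvPolynomial (XZ π ⊕ BV π) k))
      ≤ ∑ _t : Fin π.R, (12 * π.R + 24) := Finset.sum_le_sum fun t _ => by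
        rw [complexity_X_holds, add_zero]
        have h1 := complexity_rename_le_holds' (k := k) (Sum.inr : BV π → XZ π ⊕ BV π) (decBit (EJv (k := k) π) t.castSucc)
        have h2 := complexity_decBit_le (EJv (k := k) π) hJ0 t.castSucc
        omega
    _ = π.R * (12 * π.R + 24) := by simp

/-- The cost of the witness. [folklore] -/
def gWCost (D R M : ℕ) : ℕ :=
  (D + 1) * ((R + 2) * (scalCost D R M + 1) + 1) + 5 * D + (R * (12 * R + 24) + 5 * R) + 2

/-- **`L(gW) ≤ gWCost D R M`**, a polynomial in `D, R, M`. [cite: Burgisser2000, Prop. 2.20 (g ∈ VP)] -/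
theorem complexity_gW_le : complexity (gW (k := k) π) ≤ gWCost π.D π.R π.M := by
  unfold gW gWCost
  have h1 := complexity_SC_le (k := k) π
  have h1' := complexity_rename_le_holds' (k := k) (Sum.inr : BV π → XZ π ⊕ BV π) (SC (k := k) π)
  have h2 := complexity_XMON_le (k := k) π
  have h3 := complexity_ZMON_le (k := k) π
  have m1 := complexity_mul_le_holds (rename Sum.inr (SC (k := k) π) : MvPolynomial (XZ π ⊕ BV π) k) (XMON π)
  have m2 := complexity_mul_le_holds (rename Sum.inr (SC (k := k) π) * XMON π : MvPolynomial (XZ π ⊕ BV π) k) (ZMON π)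
  omega

/-- `deg(IND) ≤ 2D + 3R + 5`. [folklore] -/
theorem totalDegree_IND_le (ℓα ℓj : ℕ) : (IND (k := k) π ℓα ℓj).totalDegree ≤ 2 * π.D + 3 * π.R + 5 := by
  unfold IND
  have hA1 : ∀ t, (EAv (k := k) π t).totalDegree ≤ 1 := fun t => totalDegree_X_le_one' (k := k) _
  have hJ1 : ∀ t, (EJv (k := k) π t).totalDegree ≤ 1 := fun t => totalDegree_X_le_one' (k := k) _
  have h1 := totalDegree_lenInd_le (EAv (k := k) π) hA1 ℓα
  have h2 := totalDegree_lenInd_le (EJv (k := k) π) hJ1 ℓj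
  have h3 := totalDegree_allZeroFrom_le (EAv (k := k) π) hA1 π.P
  have h4 := totalDegree_jnzInd_le (EJv (k := k) π) hJ1
  have h5 := totalDegree_jleInd_le (EJv (k := k) π) hJ1
  refine (totalDegree_mul _ _).trans ?_
  refine (Nat.add_le_add_right ((totalDegree_mul _ _).trans (Nat.add_le_add_right ((totalDegree_mul _ _).trans
    (Nat.add_le_add_right (totalDegree_mul _ _) _)) _)) _).trans ?_
  omega

/-- `deg(SCAL) ≤ 2D + 3R + 6M + 7` (in range). [folklore] -/
theorem totalDegree_SCAL_le {ℓα ℓj : ℕ} (hℓα : ℓα ≤ π.D) (hℓj : ℓj ≤ π.R + 1) :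
    (SCAL (k := k) π ℓα ℓj).totalDegree ≤ 2 * π.D + 3 * π.R + 6 * π.M + 7 := by
  unfold SCAL
  have h1 := totalDegree_IND_le (k := k) π ℓα ℓj
  have h2 : (BIT (k := k) π ℓα ℓj).totalDegree ≤ 3 * π.M + 1 := by
    unfold BIT
    refine (totalDegree_bind₁_le (fun v => (isVarOrConst_σb π ℓα ℓj v).totalDegree_le) _).trans ?_
    rw [← size_Qw π hℓα hℓj]; exact totalDegree_arith_le _
  have h3 : (SGN (k := k) π ℓα).totalDegree ≤ 3 * π.M + 1 := by
    unfold SGN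
    refine (totalDegree_bind₁_le (fun v => (isVarOrConst_σs π ℓα v).totalDegree_le) _).trans ?_
    rw [← size_Qw π hℓα (Nat.zero_le _)]; exact totalDegree_sgnArith_le _
  refine (totalDegree_mul _ _).trans ((Nat.add_le_add_right (totalDegree_mul _ _) _).trans ?_)
  omega

/-- `deg(SC) ≤ 2D + 3R + 6M + 7`. [folklore] -/
theorem totalDegree_SC_le : (SC (k := k) π).totalDegree ≤ 2 * π.D + 3 * π.R + 6 * π.M + 7 := by
  unfold SC
  refine (totalDegree_finsetSum _ _).trans (Finset.sup_le fun ℓα hℓα => ?_)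
  refine (totalDegree_finsetSum _ _).trans (Finset.sup_le fun ℓj hℓj => ?_)
  exact totalDegree_SCAL_le π (by rw [Finset.mem_range] at hℓα; omega) (by rw [Finset.mem_range] at hℓj; omega)

/-- **`deg(gW) ≤ 2D + 3R + 6M + 7 + 2D + R(R+3)`**. [folklore] -/
theorem totalDegree_gW_le :
    (gW (k := k) π).totalDegree ≤ (2 * π.D + 3 * π.R + 6 * π.M + 7) + 2 * π.D + π.R * (π.R + 3) := by
  unfold gW
  have h1 := (totalDegree_rename_le (Sum.inr : BV π → XZ π ⊕ BV π) (SC (k := k) π)).trans (totalDegree_SC_le π)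
  have h2 : (XMON (k := k) π).totalDegree ≤ 2 * π.D := by
    unfold XMON
    refine (totalDegree_selProd_le _ _).trans ?_
    calc ∑ t : Fin π.D, ((X (Sum.inr (Sum.inl t)) : MvPolynomial (XZ π ⊕ BV π) k).totalDegree +
          (X (Sum.inl (Sum.inl t)) : MvPolynomial (XZ π ⊕ BV π) k).totalDegree)
        ≤ ∑ _t : Fin π.D, 2 := Finset.sum_le_sum fun t _ =>
          Nat.add_le_add (totalDegree_X_le_one' (k := k) _) (totalDegree_X_le_one' (k := k) _)
      _ = 2 * π.D := by simp [mul_comm]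
  have h3 : (ZMON (k := k) π).totalDegree ≤ π.R * (π.R + 3) := by
    unfold ZMON
    refine (totalDegree_selProd_le _ _).trans ?_
    have hJ1 : ∀ t, (EJv (k := k) π t).totalDegree ≤ 1 := fun t => totalDegree_X_le_one' (k := k) _
    calc ∑ t : Fin π.R, ((rename Sum.inr (decBit (EJv (k := k) π) t.castSucc) : MvPolynomial (XZ π ⊕ BV π) k).totalDegree +
          (X (Sum.inl (Sum.inr t)) : MvPolynomial (XZ π ⊕ BV π) k).totalDegree)
        ≤ ∑ _t : Fin π.R, (π.R + 3) := Finset.sum_le_sum fun t _ => by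
          have := (totalDegree_rename_le (Sum.inr : BV π → XZ π ⊕ BV π) (decBit (EJv (k := k) π) t.castSucc)).trans
            (totalDegree_decBit_le (EJv (k := k) π) hJ1 t.castSucc)
          have h' := totalDegree_X_le_one' (k := k) (Sum.inl (Sum.inr t) : XZ π ⊕ BV π)
          omega
      _ = π.R * (π.R + 3) := by simp
  refine (totalDegree_mul _ _).trans ((Nat.add_le_add_right (totalDegree_mul _ _) _).trans ?_)
  omega

end DefVNP

end Literature.Computability.AlgebraicComplexity
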